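import Summits.RiemannHypothesis.RiemannHypothesis.Theorems.WeilCombCombShapePositivityStubReductionLocal
import Summits.RiemannHypothesis.RiemannHypothesis.Theorems.WeilCombCombShapePositivityStubGram
import Summits.RiemannHypothesis.RiemannHypothesis.Theorems.WeilCombCombShapePositivityStubSymbolExpSum

/-!
# Stub `stub_twoPrimeCollapse` (plan ★T3) of line `Sketch` for crux `WeilComb.CombShapePositivity`
(item stmt-RiemannHypothesis-11229, route route-RiemannHypothesis-WeilComb, stub-plan
`Cruxes/CombShapePositivity/STUB-PLAN-stub_fejer.md`, tier T3 "two-prime collapse at fixed `ε`")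

Notation: `φ_ε(t) = ε⁻¹ expNegInvGlue (1 − (t/ε)²)`, `ψ_ε = φ_ε ⋆ φ̃_ε`, comb symbol
`w_ε(x) = W(τ_x ψ_ε)`, `Q(g) = weilQuadratic g`, Bohr character `χ_θ(d) = exp(i Σ_{p∈S} θ_p v_p(d))`.

**Statement.** At FIXED `ε > 0`, ONE prime torus of dimension `≥ 2` carries every crux cell: if `S` is
a finite set of primes with `1 < |S|` and the Fejér faces
`Re Σ_{d,d' ∣ ∏_{p∈S} p^n} χ_θ(d) conj χ_θ(d') w_ε(log d − log d')` are `≥ 0` for all `n`, `θ`, then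
`0 ≤ Re Q(Σ_{m ≤ M} a_m φ_ε(· − log m))` for all `M`, `a`.

**Proof.** (T3a) `reduction_local` (S-local Bohr–Fejér reduction, `n₀ = 0`): the node form
`Σ c_m conj c_{m'} w_ε(log m − log m')` is `≥ 0` on every finite set of `S`-smooth integer nodes.
(lattice) For `p ≠ q` in `S` and nodes `x_i = a_i log p + b_i log q` (`a_i, b_i ∈ ℤ`), the common shift
`m_i = p^{a_i+A} q^{b_i+B}` makes the nodes integral with `log m_i − log m_j = x_i − x_j`; merging the
coefficients of coincident `m_i` gives PSD at all nodes of `G = ℤ log p + ℤ log q`.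
(T3b) `G` is dense: by `AddSubgroup.dense_or_cyclic` it is dense or cyclic `ℤ g`, and cyclic would give
`l log p = k log q`, `p^{|l|} = q^{|k|}` with `l ≠ 0`, contradicting `p ≠ q`.
(T3c) `w_ε` is continuous (`continuous_symbol`), so `{x : 0 ≤ Re Σ c_i conj c_j w_ε(x_i − x_j)}` is closed
and contains the dense set `G^ι` (`dense_pi`): PSD at arbitrary real nodes, in particular at
`log 1, …, log M`; the Gram identity `stub_gram` turns this into the cell.
-/

noncomputable section

-- the sub-problem path RiemannHypothesis/RiemannHypothesis duplicates a namespace (D-0017)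
set_option linter.dupNamespace false

open scoped BigOperators ComplexConjugate
open Complex

namespace Summit.RiemannHypothesis.RiemannHypothesis.Theorems.WeilCombBohrFejer

open Literature.NumberTheory.LFunctions

/-- **T3b.** For distinct primes `p ≠ q` the subgroup `ℤ log p + ℤ log q` of `ℝ` is dense
(`AddSubgroup.dense_or_cyclic`: a cyclic generator `g` would give `log p = k g`, `log q = l g`, hence
`l log p = k log q`, `p^{|l|} = q^{|k|}` with `l ≠ 0`, so `p ∣ q`). [folklore] -/
theorem dense_two_logs {p q : ℕ} (hp : p.Prime) (hq : q.Prime) (hpq : p ≠ q) :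
    Dense ((AddSubgroup.closure ({Real.log (p : ℝ), Real.log (q : ℝ)} : Set ℝ) : AddSubgroup ℝ) :
      Set ℝ) := by
  refine (AddSubgroup.dense_or_cyclic _).resolve_right ?_
  rintro ⟨g, hg⟩
  have hmem : ∀ x ∈ ({Real.log (p : ℝ), Real.log (q : ℝ)} : Set ℝ), ∃ k : ℤ, k • g = x := by
    intro x hx
    have hx' : x ∈ AddSubgroup.closure ({Real.log (p : ℝ), Real.log (q : ℝ)} : Set ℝ) :=
      AddSubgroup.subset_closure hx
    rw [hg] at hx'
    exact AddSubgroup.mem_closure_singleton.mp hx'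
  obtain ⟨k, hk⟩ := hmem _ (Set.mem_insert _ _)
  obtain ⟨l, hl⟩ := hmem _ (Set.mem_insert_of_mem _ rfl)
  rw [zsmul_eq_mul] at hk hl
  have hp0 : 0 < Real.log p := Real.log_pos (by exact_mod_cast hp.one_lt)
  have hq0 : 0 < Real.log q := Real.log_pos (by exact_mod_cast hq.one_lt)
  have hrel : (l : ℝ) * Real.log p = k * Real.log q := by
    rw [← hk, ← hl]
    ring
  have hl0 : l ≠ 0 := by
    rintro rfl
    simp only [Int.cast_zero, zero_mul] at hl
    exact hq0.ne hl
  have hrel' : (l.natAbs : ℝ) * Real.log p = (k.natAbs : ℝ) * Real.log q := by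
    have h := congrArg abs hrel
    rwa [abs_mul, abs_mul, abs_of_pos hp0, abs_of_pos hq0, ← Int.cast_abs, ← Int.cast_abs,
      ← Nat.cast_natAbs, ← Nat.cast_natAbs] at h
  have hpow : (p : ℝ) ^ l.natAbs = (q : ℝ) ^ k.natAbs := by
    rw [← Real.exp_log (pow_pos (by exact_mod_cast hp.pos) l.natAbs), Real.log_pow, hrel',
      ← Real.log_pow, Real.exp_log (pow_pos (by exact_mod_cast hq.pos) k.natAbs)]
  have hpow' : p ^ l.natAbs = q ^ k.natAbs := by exact_mod_cast hpow
  have hdvd : p ∣ q ^ k.natAbs := hpow' ▸ dvd_pow_self p (Int.natAbs_ne_zero.mpr hl0)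
  exact hpq ((Nat.prime_dvd_prime_iff_eq hp hq).mp (hp.dvd_of_dvd_pow hdvd))

/-- **T3c.** PSD of the node forms of a CONTINUOUS kernel passes from nodes in a dense set `G ⊆ ℝ` to
arbitrary real nodes: the superlevel set `{x : 0 ≤ Re Σ c_i conj c_j w(x_i − x_j)}` is closed in
`ι → ℝ` and contains the dense set `G^ι` (`dense_pi`). [folklore] -/
theorem psd_of_dense {w : ℝ → ℂ} (hw : Continuous w) {G : Set ℝ} (hG : Dense G)
    {ι : Type*} (I : Finset ι) (c : ι → ℂ)
    (hpos : ∀ y : ι → ℝ, (∀ i ∈ I, y i ∈ G) →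
      0 ≤ (∑ i ∈ I, ∑ j ∈ I, c i * conj (c j) * w (y i - y j)).re)
    (x : ι → ℝ) : 0 ≤ (∑ i ∈ I, ∑ j ∈ I, c i * conj (c j) * w (x i - x j)).re := by
  have hF : Continuous fun y : ι → ℝ => (∑ i ∈ I, ∑ j ∈ I, c i * conj (c j) * w (y i - y j)).re :=
    Complex.continuous_re.comp (continuous_finsetSum I fun i _ =>
      continuous_finsetSum I fun j _ =>
        continuous_const.mul (hw.comp ((continuous_apply i).sub (continuous_apply j))))
  have hclosed : IsClosed {y : ι → ℝ |
      0 ≤ (∑ i ∈ I, ∑ j ∈ I, c i * conj (c j) * w (y i - y j)).re} :=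
    isClosed_le continuous_const hF
  have hdense : Dense (Set.pi Set.univ fun _ : ι => G) := dense_pi Set.univ fun _ _ => hG
  have hsub : (Set.pi Set.univ fun _ : ι => G) ⊆ {y : ι → ℝ |
      0 ≤ (∑ i ∈ I, ∑ j ∈ I, c i * conj (c j) * w (y i - y j)).re} :=
    fun y hy => hpos y fun i _ => Set.mem_univ_pi.mp hy i
  have huniv : {y : ι → ℝ | 0 ≤ (∑ i ∈ I, ∑ j ∈ I, c i * conj (c j) * w (y i - y j)).re} =
      Set.univ :=
    hclosed.closure_eq.symm.trans (hdense.mono hsub).closure_eq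
  have hx : x ∈ {y : ι → ℝ | 0 ≤ (∑ i ∈ I, ∑ j ∈ I, c i * conj (c j) * w (y i - y j)).re} := by
    rw [huniv]
    exact Set.mem_univ x
  exact hx

/-- Merging the coefficients of coincident nodes: for nodes `m i` (`i ∈ I`) and
`c'_n = Σ_{i : m i = n} c_i`, the form on the distinct nodes `I.image m` with coefficients `c'`
equals the form on `I` with coefficients `c`. [folklore] -/
private theorem sum_image_merge {ι : Type*} (I : Finset ι) (m : ι → ℕ) (c : ι → ℂ)
    (K : ℕ → ℕ → ℂ) :
    ∑ n ∈ I.image m, ∑ n' ∈ I.image m,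
        (∑ i ∈ I with m i = n, c i) * conj (∑ i ∈ I with m i = n', c i) * K n n' =
      ∑ i ∈ I, ∑ j ∈ I, c i * conj (c j) * K (m i) (m j) := by
  have hmaps : ∀ i ∈ I, m i ∈ I.image m := fun i hi => Finset.mem_image_of_mem m hi
  calc ∑ n ∈ I.image m, ∑ n' ∈ I.image m,
        (∑ i ∈ I with m i = n, c i) * conj (∑ i ∈ I with m i = n', c i) * K n n'
      = ∑ n ∈ I.image m, ∑ n' ∈ I.image m,
          ∑ i ∈ I with m i = n, ∑ j ∈ I with m j = n', c i * conj (c j) * K (m i) (m j) := by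
        refine Finset.sum_congr rfl fun n _ => Finset.sum_congr rfl fun n' _ => ?_
        rw [map_sum, Finset.sum_mul_sum, Finset.sum_mul]
        refine Finset.sum_congr rfl fun i hi => ?_
        rw [Finset.sum_mul]
        refine Finset.sum_congr rfl fun j hj => ?_
        rw [(Finset.mem_filter.mp hi).2, (Finset.mem_filter.mp hj).2]
    _ = ∑ n ∈ I.image m, ∑ i ∈ I with m i = n, ∑ n' ∈ I.image m, ∑ j ∈ I with m j = n',
          c i * conj (c j) * K (m i) (m j) := by
        refine Finset.sum_congr rfl fun n _ => ?_
        rw [Finset.sum_comm]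
    _ = ∑ i ∈ I, ∑ j ∈ I, c i * conj (c j) * K (m i) (m j) := by
        rw [Finset.sum_fiberwise_of_maps_to hmaps]
        refine Finset.sum_congr rfl fun i _ => ?_
        rw [Finset.sum_fiberwise_of_maps_to hmaps]

/-- PSD at the LATTICE nodes `x_i = a_i log p + b_i log q` (`a_i, b_i ∈ ℤ`, `p, q ∈ S` primes) from
PSD at every finite set of `S`-smooth integer nodes: the common shift `m_i = p^{a_i+A} q^{b_i+B}`
(`A, B` large) gives `S`-smooth integers with `log m_i − log m_j = x_i − x_j`; coincident nodes are
merged by `sum_image_merge`. [folklore] -/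
private theorem psd_lattice {w : ℝ → ℂ} {S : Finset ℕ} {p q : ℕ} (hp : p.Prime) (hq : q.Prime)
    (hpS : p ∈ S) (hqS : q ∈ S)
    (hT : ∀ T : Finset ℕ, (∀ m ∈ T, m ≠ 0 ∧ m.primeFactors ⊆ S) → ∀ c : ℕ → ℂ,
      0 ≤ (∑ m ∈ T, ∑ m' ∈ T,
        c m * conj (c m') * w (Real.log (m : ℝ) - Real.log (m' : ℝ))).re)
    {ι : Type*} (I : Finset ι) (a b : ι → ℤ) (c : ι → ℂ) :
    0 ≤ (∑ i ∈ I, ∑ j ∈ I, c i * conj (c j) *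
      w (((a i : ℝ) - a j) * Real.log p + ((b i : ℝ) - b j) * Real.log q)).re := by
  classical
  -- common shifts `A ≥ -a i`, `B ≥ -b i`
  set A : ℤ := ∑ j ∈ I, |a j| with hA_def
  set B : ℤ := ∑ j ∈ I, |b j| with hB_def
  have hA : ∀ i ∈ I, 0 ≤ a i + A := fun i hi => by
    have h1 := neg_le_abs (a i)
    have h2 : |a i| ≤ A := Finset.single_le_sum (fun j _ => abs_nonneg (a j)) hi
    omega
  have hB : ∀ i ∈ I, 0 ≤ b i + B := fun i hi => by
    have h1 := neg_le_abs (b i)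
    have h2 : |b i| ≤ B := Finset.single_le_sum (fun j _ => abs_nonneg (b j)) hi
    omega
  -- the integer nodes
  obtain ⟨m, hm_def⟩ : ∃ m : ι → ℕ, ∀ i, m i = p ^ (a i + A).toNat * q ^ (b i + B).toNat :=
    ⟨_, fun _ => rfl⟩
  have hm0 : ∀ i, m i ≠ 0 := fun i => by
    rw [hm_def]
    exact mul_ne_zero (pow_ne_zero _ hp.ne_zero) (pow_ne_zero _ hq.ne_zero)
  have hmS : ∀ i, (m i).primeFactors ⊆ S := fun i r hr => by
    obtain ⟨hr, hrd, -⟩ := Nat.mem_primeFactors.mp hr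
    rw [hm_def] at hrd
    rcases (Nat.Prime.dvd_mul hr).mp hrd with h | h
    · rwa [(Nat.prime_dvd_prime_iff_eq hr hp).mp (hr.dvd_of_dvd_pow h)]
    · rwa [(Nat.prime_dvd_prime_iff_eq hr hq).mp (hr.dvd_of_dvd_pow h)]
  have hlog : ∀ i ∈ I, Real.log (m i : ℝ) =
      ((a i : ℝ) + A) * Real.log p + ((b i : ℝ) + B) * Real.log q := by
    intro i hi
    have h1 : (((a i + A).toNat : ℕ) : ℝ) = (a i : ℝ) + A := by
      have := Int.toNat_of_nonneg (hA i hi)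
      exact_mod_cast this
    have h2 : (((b i + B).toNat : ℕ) : ℝ) = (b i : ℝ) + B := by
      have := Int.toNat_of_nonneg (hB i hi)
      exact_mod_cast this
    rw [hm_def, Nat.cast_mul, Nat.cast_pow, Nat.cast_pow,
      Real.log_mul (pow_ne_zero _ (by exact_mod_cast hp.ne_zero))
        (pow_ne_zero _ (by exact_mod_cast hq.ne_zero)),
      Real.log_pow, Real.log_pow, h1, h2]
  have hdiff : ∀ i ∈ I, ∀ j ∈ I, Real.log (m i : ℝ) - Real.log (m j : ℝ) =
      ((a i : ℝ) - a j) * Real.log p + ((b i : ℝ) - b j) * Real.log q := by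
    intro i hi j hj
    rw [hlog i hi, hlog j hj]
    ring
  -- PSD at the distinct integer nodes `I.image m` with merged coefficients
  have key : 0 ≤ (∑ n ∈ I.image m, ∑ n' ∈ I.image m,
      (∑ i ∈ I with m i = n, c i) * conj (∑ i ∈ I with m i = n', c i) *
        w (Real.log (n : ℝ) - Real.log (n' : ℝ))).re :=
    hT (I.image m) (fun n hn => by
      obtain ⟨i, -, rfl⟩ := Finset.mem_image.mp hn
      exact ⟨hm0 i, hmS i⟩) _
  rw [sum_image_merge I m c fun n n' => w (Real.log (n : ℝ) - Real.log (n' : ℝ))] at key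
  rw [Finset.sum_congr rfl fun i hi => Finset.sum_congr rfl fun j hj => by rw [← hdiff i hi j hj]]
  exact key

/-- PSD at nodes in `G = ℤ log p + ℤ log q` (`AddSubgroup.mem_closure_pair` + `psd_lattice`).
[folklore] -/
private theorem psd_closure_pair {w : ℝ → ℂ} {S : Finset ℕ} {p q : ℕ} (hp : p.Prime)
    (hq : q.Prime) (hpS : p ∈ S) (hqS : q ∈ S)
    (hT : ∀ T : Finset ℕ, (∀ m ∈ T, m ≠ 0 ∧ m.primeFactors ⊆ S) → ∀ c : ℕ → ℂ,
      0 ≤ (∑ m ∈ T, ∑ m' ∈ T,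
        c m * conj (c m') * w (Real.log (m : ℝ) - Real.log (m' : ℝ))).re)
    {ι : Type*} (I : Finset ι) (x : ι → ℝ) (c : ι → ℂ)
    (hx : ∀ i ∈ I, x i ∈ AddSubgroup.closure ({Real.log (p : ℝ), Real.log (q : ℝ)} : Set ℝ)) :
    0 ≤ (∑ i ∈ I, ∑ j ∈ I, c i * conj (c j) * w (x i - x j)).re := by
  have hab : ∀ i, ∃ ab : ℤ × ℤ, i ∈ I →
      (ab.1 : ℝ) * Real.log p + (ab.2 : ℝ) * Real.log q = x i := by
    intro i
    by_cases hi : i ∈ I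
    · obtain ⟨k, l, hkl⟩ := AddSubgroup.mem_closure_pair.mp (hx i hi)
      refine ⟨(k, l), fun _ => ?_⟩
      simpa only [zsmul_eq_mul] using hkl
    · exact ⟨(0, 0), fun h => absurd h hi⟩
  choose ab hab using hab
  have key := psd_lattice hp hq hpS hqS hT I (fun i => (ab i).1) (fun i => (ab i).2) c
  rw [Finset.sum_congr rfl fun i hi => Finset.sum_congr rfl fun j hj => by
    rw [show x i - x j = (((ab i).1 : ℝ) - (ab j).1) * Real.log p +
        (((ab i).2 : ℝ) - (ab j).2) * Real.log q by rw [← hab i hi, ← hab j hj]; ring]]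
  exact key

/-- The collapse for an arbitrary CONTINUOUS kernel `w`: if the node forms of `w` are PSD on every
finite set of `S`-smooth integer nodes (`S` a set of primes with two distinct elements), they are PSD
at arbitrary real nodes (`psd_closure_pair`, `dense_two_logs`, `psd_of_dense`). [folklore] -/
theorem psd_of_psd_smooth {w : ℝ → ℂ} (hw : Continuous w) {S : Finset ℕ} (hS : ∀ p ∈ S, p.Prime)
    (hcard : 1 < S.card)
    (hT : ∀ T : Finset ℕ, (∀ m ∈ T, m ≠ 0 ∧ m.primeFactors ⊆ S) → ∀ c : ℕ → ℂ,
      0 ≤ (∑ m ∈ T, ∑ m' ∈ T,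
        c m * conj (c m') * w (Real.log (m : ℝ) - Real.log (m' : ℝ))).re)
    {ι : Type*} (I : Finset ι) (x : ι → ℝ) (c : ι → ℂ) :
    0 ≤ (∑ i ∈ I, ∑ j ∈ I, c i * conj (c j) * w (x i - x j)).re := by
  obtain ⟨p, hpS, q, hqS, hpq⟩ := Finset.one_lt_card.mp hcard
  exact psd_of_dense hw (dense_two_logs (hS p hpS) (hS q hqS) hpq) I c
    (fun y hy => psd_closure_pair (hS p hpS) (hS q hqS) hpS hqS hT I y c hy) x

/-- **★T3 `stub_twoPrimeCollapse` — two-prime collapse at fixed `ε`.** For `ε > 0` and a finite set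
of primes `S` with `1 < |S|`: if every Fejér face `Re Σ_{d,d' ∣ ∏_{p∈S} p^n} χ_θ(d) conj χ_θ(d')
W(τ_{log d − log d'}(φ_ε ⋆ φ̃_ε))` is nonnegative, then every crux cell at that `ε` is nonnegative:
`0 ≤ Re Q(Σ_{m ≤ M} a_m φ_ε(· − log m))`. (Gram identity `stub_gram`; `reduction_local` with `n₀ = 0`;
density of `ℤ log p + ℤ log q` and continuity of the symbol, `psd_of_psd_smooth`.) [folklore] -/
theorem stub_twoPrimeCollapse : ∀ ε : ℝ, 0 < ε → ∀ S : Finset ℕ, (∀ p ∈ S, p.Prime) → 1 < S.card →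
    (∀ (n : ℕ) (θ : ℕ → ℝ),
      0 ≤ (∑ d ∈ (∏ p ∈ S, p ^ n).divisors, ∑ d' ∈ (∏ p ∈ S, p ^ n).divisors,
        Complex.exp (I * ((∑ p ∈ S, θ p * (d.factorization p : ℝ) : ℝ) : ℂ)) *
          conj (Complex.exp (I * ((∑ p ∈ S, θ p * (d'.factorization p : ℝ) : ℝ) : ℂ))) *
          weilFunctional (weilTranslate
            (weilConv (fun t : ℝ => (ε : ℂ)⁻¹ * ((expNegInvGlue (1 - (t / ε) ^ 2) : ℝ) : ℂ))
              (weilReflect (fun t : ℝ => (ε : ℂ)⁻¹ * ((expNegInvGlue (1 - (t / ε) ^ 2) : ℝ) : ℂ))))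
            (Real.log (d : ℝ) - Real.log (d' : ℝ)))).re) →
    ∀ (M : ℕ) (a : ℕ → ℂ), 0 ≤ (weilQuadratic (fun x : ℝ => ∑ m ∈ Finset.Icc 1 M,
      a m * ((ε : ℂ)⁻¹ * ((expNegInvGlue (1 - ((x - Real.log (m : ℝ)) / ε) ^ 2) : ℝ) : ℂ)))).re := by
  intro ε hε S hS hcard hface M a
  -- Gram identity: the cell is the node form of the symbol `w_ε` at the nodes `log 1, …, log M`
  rw [stub_gram ε hε M a]
  -- the symbol `w_ε` is continuous (T1')
  have hw : Continuous fun x : ℝ => weilFunctional (weilTranslate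
      (weilConv (fun t : ℝ => (ε : ℂ)⁻¹ * ((expNegInvGlue (1 - (t / ε) ^ 2) : ℝ) : ℂ))
        (weilReflect (fun t : ℝ => (ε : ℂ)⁻¹ * ((expNegInvGlue (1 - (t / ε) ^ 2) : ℝ) : ℂ)))) x) :=
    continuous_symbol ε
  -- its node forms are PSD on every finite set of `S`-smooth integer nodes (T3a with `n₀ = 0`)
  have hT := reduction_local (fun x : ℝ => weilFunctional (weilTranslate
      (weilConv (fun t : ℝ => (ε : ℂ)⁻¹ * ((expNegInvGlue (1 - (t / ε) ^ 2) : ℝ) : ℂ))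
        (weilReflect (fun t : ℝ => (ε : ℂ)⁻¹ * ((expNegInvGlue (1 - (t / ε) ^ 2) : ℝ) : ℂ)))) x))
    S hS 0 fun n _ θ => hface n θ
  -- collapse to the real nodes `log m`, `m ∈ [1, M]`
  have h := psd_of_psd_smooth hw hS hcard hT (Finset.Icc 1 M) (fun m : ℕ => Real.log (m : ℝ)) a
  exact h

end Summit.RiemannHypothesis.RiemannHypothesis.Theorems.WeilCombBohrFejer

end
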